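import Summits.Ventures.GridStability.Lyapunov.WSCC9SP9SlabRateData
import Literature.MathematicalPhysics.PowerSystems.LuriePostnikovSlabDecayRate

/-!
# GridStability/Bench/WSCC9SP9SlabRate — #94-cand «G2.b-SP9-SLAB-RATE»: the certified DECAY TIME CONSTANT inside ★ #45's well
# (one application of lit-6's class theorem to ★ #45's certificate, BY NAME)

Cell `gridfusion` (LADDER-GRIDFUSION), SP–Lur'e lane; lead g6 RULING 7d (2026-08-27T12:58Z); seat gridfusion-model-2 (g7).
OBJECT: ★ #45 «G2.b-SP9-SLAB» — `Summit.Ventures.GridStability.Bench.WSCC9SP9Slab.cert : SlabCertificate (WSCC9SP.relLurie D)`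
(Bench/WSCC9SP9SlabRoa p504776 on Lyapunov/WSCC9SP9SlabData p503918): MODEL M′_D = `(WSCC9SP.params D).phaseField` (the 9-node
structure-preserving WSCC 3-machine model, post-fault network B, column V1, relative to bus 9, DECLARED damping `D = DQ`), CLASS C =
★ #45's certified well (`|σ_e(0) − σ*_e| ≤ 97/200` on the 8 listed lines and `V(relState) ≤ cQ = 366951/655360000`). NEW DATA: the
single literal `p₂ = p2Q = 4099/1024` and the kernel-decided PSD fact `p₂•1 − (P + Cᵀ·diag(λ_k b_k)·C) ⪰ 0` of
`Lyapunov/WSCC9SP9SlabRateData` (sos-2 object 0bb1f553916eb76b). CLASS THEOREM: lit-6's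
`SlabCertificate.sqrt_dotProduct_le_of_well` / `dotProduct_le_mul_exp_neg_of_well` (Literature/…/LuriePostnikovSlabDecayRate.lean;
Khalil Thm 4.10 with (k₁, k₂, k₃, a) = (ε, p₂, η, 2)) [cite: Khalil2002, Theorem 4.10; Pai1981, §2.16 Theorem [18] eq. (2.63)].
WHAT IS PROVED: (1) `upperMatrix_eq` — ★ #45's upper comparison matrix `cert.upperMatrix = P + Cᵀ·diag(λ·b)·C` is the cast of the
rational matrix `UQ := PQ + CQᵀ·diag(lamQ)·CQ` (b ≡ 1), and `UQ = WRq.submatrix e1 e1` (kernel `decide`): the Data file's flattened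
`WRq` IS the upper matrix; (2) `upper_posSemidef : (p₂•1 − cert.upperMatrix).PosSemidef` (transport of `posSemidefR`); (3) the slab
hypotheses `hsec` / `hfr` of ★ #45's well, rebuilt from the SAME instance facts ★ #45 used (`lineAngle_abs_le_theta`, `tauV1 < 1`,
`a_le_slabSlope`, `one_le_b`, `hc`; u = 1/4, γ_lo = 97/200); (4) **`sp9_slab_rate`**: for every phase solution `X` of M′_D from a
point `y` of class C and every `t ≥ 0`, the relative state `x(t) = relState(X t)` obeys
`‖x(t)‖₂ ≤ √(p₂/ε)·‖x(0)‖₂·e^{−(η/(2p₂))·t}` with `ε = 39/8192`, `η = 1/1000`, `p₂ = 4099/1024` — a certified decay TIME CONSTANT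
`2p₂/η = 512375/64 ≈ 8006` (model time unit: seconds) and amplitude factor `√(p₂/ε) = √(32792/39) ≈ 29.0` inside the region;
(4′) `sp9_slab_rate_sq` the squared form `‖x(t)‖² ≤ (p₂/ε)‖x(0)‖²e^{−(η/p₂)t}`. SUFFICIENT, NOT SHARP (the certificate's η is a
feasibility-grade decay margin, so the time constant is loose by orders of magnitude against any simulated damping — that
comparison is VALIDATED-column and not made here). THREE COLUMNS. CERTIFIED: (2), (4), (4′) for MODEL M′_D and CLASS C. MODELLED
as ★ #45 verbatim: «MV-3 + lossless + MV-RD(0.046 @ slack G1) + D⟨declared: MV-SPD transplant machines, buses 1/10 synthetic⟩ +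
V-frozen(V1) + ω_R = 377 printed + ref bus 9; a structure-preserving VARIANT of the printed 9-bus, not a 9-bus sentence». VALIDATED:
λ_max(W) ≈ 4.0016 (sos-2 power iteration), any simulated decay or small-signal damping ratio of M′, juxtaposed only. This file NEVER
says the grid damps oscillations in T seconds.
-/

noncomputable section

open Set Filter Topology Real Matrix
open Literature.MathematicalPhysics.PowerSystems
open Literature.MathematicalPhysics.PowerSystems.LyapunovFunctionFamily
open Literature.Computation.Certificates
open Summit.Ventures.GridStability.Models
open Summit.Ventures.GridStability.Models.StructurePreserving
open Summit.Ventures.GridStability.Models.WSCC9SP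
open Summit.Ventures.GridStability.Lyapunov.WSCC9SP9Slab (Pq lamQ epsQ etaQ cQ)
open Summit.Ventures.GridStability.Lyapunov.WSCC9SP9SlabRate (p2Q WRq CflatQ posSemidefR p2Q_facts)
open Summit.Ventures.GridStability.Bench.WSCC9SP9Slab (D hD e1 CQ C_eq PQ P cert a_le_slabSlope one_le_b hc)

namespace Summit.Ventures.GridStability.Bench.WSCC9SP9SlabRate

/-! ### The upper comparison matrix of ★ #45 is the Data file's `WRq` -/

/-- ★ #45's upper comparison matrix over `ℚ` on the state type: `PQ + CQᵀ·diag(lamQ)·CQ` (`b ≡ 1`). -/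
def UQ : Matrix (Fin 8 ⊕ Fin 3) (Fin 8 ⊕ Fin 3) ℚ := PQ + CQᵀ * Matrix.diagonal lamQ * CQ

/-- `UQ` is the Data file's flattened `WRq` reindexed by `e1` (kernel). -/
theorem UQ_eq : UQ = WRq.submatrix e1 e1 := by
  decide +kernel

/-- `(M·N) ↦ ℝ` = product of the casts (plumbing). -/
private theorem map_mul' {m n o : Type*} [Fintype n] (M : Matrix m n ℚ) (N : Matrix n o ℚ) :
    (M * N).map (Rat.cast : ℚ → ℝ) = M.map (Rat.cast : ℚ → ℝ) * N.map (Rat.cast : ℚ → ℝ) :=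
  Matrix.map_mul (f := Rat.castHom ℝ)

/-- `(M+N) ↦ ℝ` = sum of the casts (plumbing). -/
private theorem map_add' {m n : Type*} (M N : Matrix m n ℚ) :
    (M + N).map (Rat.cast : ℚ → ℝ) = M.map (Rat.cast : ℚ → ℝ) + N.map (Rat.cast : ℚ → ℝ) := by
  ext i j; simp

/-- transpose commutes with the cast (plumbing, `rfl`). -/
private theorem map_transpose' {m n : Type*} (M : Matrix m n ℚ) :
    Mᵀ.map (Rat.cast : ℚ → ℝ) = (M.map (Rat.cast : ℚ → ℝ))ᵀ := rfl

/-- `diag(d) ↦ ℝ = diag(d ↦ ℝ)` (plumbing). -/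
private theorem map_diagonal' {n : Type*} [DecidableEq n] (d : n → ℚ) :
    (Matrix.diagonal d).map (Rat.cast : ℚ → ℝ) = Matrix.diagonal (fun i => (d i : ℝ)) :=
  Matrix.diagonal_map Rat.cast_zero

/-- **★ #45's upper comparison matrix `P + Cᵀ·diag(λ_k b_k)·C` is the cast of `UQ`.** -/
theorem upperMatrix_eq : cert.upperMatrix = UQ.map (Rat.cast : ℚ → ℝ) := by
  have hd : Matrix.diagonal (fun k => cert.lam k * cert.b k) = (Matrix.diagonal lamQ).map (Rat.cast : ℚ → ℝ) := by
    rw [map_diagonal']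
    congr 1; funext k
    show (lamQ k : ℝ) * 1 = (lamQ k : ℝ)
    ring
  rw [SlabCertificate.upperMatrix_def, hd, C_eq]
  show P + _ = _
  rw [P, UQ]
  simp only [map_add', map_mul', map_transpose']

/-- **The rider's PSD fact on the state type**: `p₂•1 − (P + Cᵀ·diag(λ_k b_k)·C) ⪰ 0` for ★ #45's certificate, `p₂ = 4099/1024`. -/
theorem upper_posSemidef :
    ((p2Q : ℝ) • (1 : Matrix (Fin 8 ⊕ Fin 3) (Fin 8 ⊕ Fin 3) ℝ) - cert.upperMatrix).PosSemidef := by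
  have h1 : (p2Q : ℝ) • (1 : Matrix (Fin 8 ⊕ Fin 3) (Fin 8 ⊕ Fin 3) ℝ) - cert.upperMatrix
      = (((p2Q • (1 : Matrix (Fin 11) (Fin 11) ℚ) - WRq)).map (Rat.cast : ℚ → ℝ)).submatrix e1 e1 := by
    rw [upperMatrix_eq, UQ_eq]
    ext i j
    by_cases h : i = j
    · subst h; simp
    · have h' : e1 i ≠ e1 j := fun he => h (e1.injective he)
      simp [h, h']
  rw [h1]
  exact (Matrix.posSemidef_submatrix_equiv e1).2 posSemidefR

/-! ### ★ #45's well: the slab hypotheses, rebuilt from the same instance facts -/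

/-- The per-channel sector hypothesis `hsec` on the slab `|σ_e − σ*_e| ≤ 2·atan(1/4)` (as inside ★ #45's proof). -/
theorem hsec : ∀ e ξ, |ξ - (WSCC9SP.relLurie D).δs e| ≤ (fun _ : Fin 8 => 2 * Real.arctan ((1 / 4 : ℚ) : ℝ)) e →
    cert.a e ≤ Real.cos ξ ∧ Real.cos ξ ≤ cert.b e := by
  have hτ1 : ((tauV1 : ℚ) : ℝ) < 1 := by exact_mod_cast (show tauV1 < 1 by norm_num [tauV1])
  have hu0 : (0 : ℝ) < ((1 / 4 : ℚ) : ℝ) := by norm_num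
  have hu1 : (((1 / 4 : ℚ)) : ℝ) ≤ 1 := by norm_num
  have hγpos : 0 ≤ 2 * Real.arctan (((1 / 4 : ℚ)) : ℝ) :=
    Lyapunov.StructurePreserving.two_mul_arctan_nonneg hu0.le
  have hθγ : 2 * Real.arctan ((tauV1 : ℚ) : ℝ) + 2 * Real.arctan (((1 / 4 : ℚ)) : ℝ) ≤ π :=
    (two_arctan_add_lt_pi hτ1 hu1).le
  have ha' : ∀ e, cert.a e ≤ Real.cos (2 * Real.arctan ((tauV1 : ℚ) : ℝ) + 2 * Real.arctan (((1 / 4 : ℚ)) : ℝ)) :=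
    fun e => by
    rw [cos_two_arctan_add]
    have hsc : ((slabSlope (1 / 4) : ℚ) : ℝ) = ((1 - ((tauV1 : ℚ) : ℝ) ^ 2) * (1 - (((1 / 4 : ℚ)) : ℝ) ^ 2)
        - 4 * ((tauV1 : ℚ) : ℝ) * ((1 / 4 : ℚ) : ℝ)) / ((1 + ((tauV1 : ℚ) : ℝ) ^ 2) * (1 + (((1 / 4 : ℚ)) : ℝ) ^ 2)) := by
      push_cast [slabSlope]
      ring
    rw [← hsc]; exact a_le_slabSlope e
  exact Params.relLurie_slab_sector_of_window (p := WSCC9SP.params D) (r := ref) (gnode := gnode) (src := srcV)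
    (tgt := tgtV) (wt := wt) (δs := δ₀) cert hγpos hθγ lineAngle_abs_le_theta ha' one_le_b

/-- The face hypothesis `hfr`: ★ #45's ε-level `cQ` lies below `V` on the frontier of the slab. -/
theorem hfr : ∀ x ∈ frontier ((WSCC9SP.relLurie D).slab (fun _ : Fin 8 => 2 * Real.arctan ((1 / 4 : ℚ) : ℝ))),
    ((cQ : ℚ) : ℝ) < cert.V x := by
  have hu0 : (0 : ℝ) < ((1 / 4 : ℚ) : ℝ) := by norm_num
  have hγ0 : (0 : ℝ) ≤ ((97 / 200 : ℚ) : ℝ) := by norm_num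
  have hγ : (((97 / 200 : ℚ)) : ℝ) ^ 2 * (1 + (((1 / 4 : ℚ)) : ℝ) ^ 2) ≤ 4 * (((1 / 4 : ℚ)) : ℝ) ^ 2 := by norm_num
  have hlt : (((97 / 200 : ℚ)) : ℝ) < 2 * Real.arctan (((1 / 4 : ℚ)) : ℝ) := lt_two_arctan_of_sq_le hu0 hγ0 hγ
  have hc' : ∀ _e : Fin 8, 2 * ((cQ : ℚ) : ℝ) < cert.ε * (2 * Real.arctan (((1 / 4 : ℚ)) : ℝ)) ^ 2 := fun _ => by
    have hsq : (((97 / 200 : ℚ)) : ℝ) ^ 2 < (2 * Real.arctan (((1 / 4 : ℚ)) : ℝ)) ^ 2 :=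
      pow_lt_pow_left₀ hlt hγ0 two_ne_zero
    have := mul_lt_mul_of_pos_left hsq cert.ε_pos
    linarith [hc]
  exact Params.relLurie_lt_V_frontier_slab_of_eps (p := WSCC9SP.params D) (r := ref) (gnode := gnode) (src := srcV)
    (tgt := tgtV) (wt := wt) (δs := δ₀) cert hsec hc'

/-! ### The rate sentence -/

/-- **«G2.b-SP9-SLAB-RATE» — the certified decay time constant inside ★ #45's well.** For MODEL
M′_D = `(WSCC9SP.params D).phaseField` (as ★ #45) and CLASS C = ★ #45's certified well: from every phase point `y` whose 8 listed
line-angle deviations satisfy `|σ_e − σ*_e| ≤ 97/200` and whose relative state has `V ≤ cQ = 366951/655360000`, EVERY solution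
`X` with `X 0 = y` has relative state `x(t) = relState(X t)` obeying
`‖x(t)‖₂ ≤ √(p₂/ε)·‖x(0)‖₂·e^{−(η/(2p₂))·t}` for all `t ≥ 0`, with `p₂ = 4099/1024`, `ε = 39/8192`, `η = 1/1000`: a certified
decay TIME CONSTANT `2p₂/η = 512375/64 ≈ 8006` (model seconds) and amplitude factor `√(p₂/ε) = √(32792/39) ≈ 29.0` inside the
region — SUFFICIENT, NOT SHARP (Khalil Thm 4.10 shape with the certificate's feasibility-grade η). CERTIFIED for M′_D and C;
MODELLED as ★ #45 verbatim; VALIDATED: any simulated decay of M′, juxtaposed. Never «the grid damps oscillations in T seconds».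
[cite: Khalil2002, Theorem 4.10; Pai1981, §2.16 Theorem [18] eq. (2.63); VuTuritsyn2017, §4.3 Theorem 1] -/
theorem sp9_slab_rate {y : (Fin 9 → ℝ) × (Fin 9 → ℝ)}
    (hy : ∀ e, |(y.1 (srcV e) - y.1 (tgtV e)) - (δ₀ (srcV e) - δ₀ (tgtV e))| ≤ ((97 / 200 : ℚ) : ℝ))
    (hyc : cert.V (relState ref gnode δ₀ y) ≤ ((cQ : ℚ) : ℝ))
    {X : ℝ → (Fin 9 → ℝ) × (Fin 9 → ℝ)} (hX0 : X 0 = y)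
    (hX : ∀ T : ℝ, ∀ t ∈ Icc 0 T, HasDerivWithinAt X ((WSCC9SP.params D).phaseField (X t)) (Icc 0 T) t)
    {t : ℝ} (ht : 0 ≤ t) :
    Real.sqrt (relState ref gnode δ₀ (X t) ⬝ᵥ relState ref gnode δ₀ (X t))
      ≤ Real.sqrt ((p2Q : ℝ) / cert.ε) * Real.sqrt (relState ref gnode δ₀ (X 0) ⬝ᵥ relState ref gnode δ₀ (X 0))
        * Real.exp (-(cert.η / (2 * (p2Q : ℝ))) * t) := by
  subst hX0
  have hu0 : (0 : ℝ) < ((1 / 4 : ℚ) : ℝ) := by norm_num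
  have hγ0 : (0 : ℝ) ≤ ((97 / 200 : ℚ) : ℝ) := by norm_num
  have hγ : (((97 / 200 : ℚ)) : ℝ) ^ 2 * (1 + (((1 / 4 : ℚ)) : ℝ) ^ 2) ≤ 4 * (((1 / 4 : ℚ)) : ℝ) ^ 2 := by norm_num
  have hlt : (((97 / 200 : ℚ)) : ℝ) < 2 * Real.arctan (((1 / 4 : ℚ)) : ℝ) := lt_two_arctan_of_sq_le hu0 hγ0 hγ
  have h0 : ∀ e, |((X 0).1 (srcV e) - (X 0).1 (tgtV e)) - (δ₀ (srcV e) - δ₀ (tgtV e))|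
      < (fun _ : Fin 8 => 2 * Real.arctan ((1 / 4 : ℚ) : ℝ)) e := fun e => (hy e).trans_lt hlt
  have hy' : relState ref gnode δ₀ (X 0) ∈ (WSCC9SP.relLurie D).slab (fun _ : Fin 8 => 2 * Real.arctan ((1 / 4 : ℚ) : ℝ)) :=
    (Params.mem_slab_relState_iff (WSCC9SP.params D) ref gnode srcV tgtV wt δ₀ _ (X 0)).2 h0
  have hrel : ∀ T : ℝ, ∀ s ∈ Icc 0 T, HasDerivWithinAt (fun τ => relState ref gnode δ₀ (X τ))
      ((WSCC9SP.relLurie D).field (relState ref gnode δ₀ (X s))) (Icc 0 T) s :=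
    fun T s hs => Params.hasDerivWithinAt_relState (wellFormed hD) ref_gnode.1 ref_gnode.2 mem_genS_iff
      (params_b_eq D) (pe_δ₀_eq_P0 D) (hX T s hs)
  have hp : (0 : ℝ) < (p2Q : ℝ) := by exact_mod_cast p2Q_facts.1
  exact cert.sqrt_dotProduct_le_of_well hsec hfr hp upper_posSemidef hrel hy' hyc ht

/-- **The squared form** (Khalil (4.20) before taking roots): `‖x(t)‖² ≤ (p₂/ε)·‖x(0)‖²·e^{−(η/p₂)·t}`. Same MODEL, CLASS, columns.
[cite: Khalil2002, Theorem 4.10; Pai1981, §2.16 Theorem [18] eq. (2.63)] -/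
theorem sp9_slab_rate_sq {y : (Fin 9 → ℝ) × (Fin 9 → ℝ)}
    (hy : ∀ e, |(y.1 (srcV e) - y.1 (tgtV e)) - (δ₀ (srcV e) - δ₀ (tgtV e))| ≤ ((97 / 200 : ℚ) : ℝ))
    (hyc : cert.V (relState ref gnode δ₀ y) ≤ ((cQ : ℚ) : ℝ))
    {X : ℝ → (Fin 9 → ℝ) × (Fin 9 → ℝ)} (hX0 : X 0 = y)
    (hX : ∀ T : ℝ, ∀ t ∈ Icc 0 T, HasDerivWithinAt X ((WSCC9SP.params D).phaseField (X t)) (Icc 0 T) t)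
    {t : ℝ} (ht : 0 ≤ t) :
    relState ref gnode δ₀ (X t) ⬝ᵥ relState ref gnode δ₀ (X t)
      ≤ (p2Q : ℝ) / cert.ε * (relState ref gnode δ₀ (X 0) ⬝ᵥ relState ref gnode δ₀ (X 0))
        * Real.exp (-(cert.η / (p2Q : ℝ)) * t) := by
  subst hX0
  have hu0 : (0 : ℝ) < ((1 / 4 : ℚ) : ℝ) := by norm_num
  have hγ0 : (0 : ℝ) ≤ ((97 / 200 : ℚ) : ℝ) := by norm_num
  have hγ : (((97 / 200 : ℚ)) : ℝ) ^ 2 * (1 + (((1 / 4 : ℚ)) : ℝ) ^ 2) ≤ 4 * (((1 / 4 : ℚ)) : ℝ) ^ 2 := by norm_num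
  have hlt : (((97 / 200 : ℚ)) : ℝ) < 2 * Real.arctan (((1 / 4 : ℚ)) : ℝ) := lt_two_arctan_of_sq_le hu0 hγ0 hγ
  have h0 : ∀ e, |((X 0).1 (srcV e) - (X 0).1 (tgtV e)) - (δ₀ (srcV e) - δ₀ (tgtV e))|
      < (fun _ : Fin 8 => 2 * Real.arctan ((1 / 4 : ℚ) : ℝ)) e := fun e => (hy e).trans_lt hlt
  have hy' : relState ref gnode δ₀ (X 0) ∈ (WSCC9SP.relLurie D).slab (fun _ : Fin 8 => 2 * Real.arctan ((1 / 4 : ℚ) : ℝ)) :=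
    (Params.mem_slab_relState_iff (WSCC9SP.params D) ref gnode srcV tgtV wt δ₀ _ (X 0)).2 h0
  have hrel : ∀ T : ℝ, ∀ s ∈ Icc 0 T, HasDerivWithinAt (fun τ => relState ref gnode δ₀ (X τ))
      ((WSCC9SP.relLurie D).field (relState ref gnode δ₀ (X s))) (Icc 0 T) s :=
    fun T s hs => Params.hasDerivWithinAt_relState (wellFormed hD) ref_gnode.1 ref_gnode.2 mem_genS_iff
      (params_b_eq D) (pe_δ₀_eq_P0 D) (hX T s hs)
  have hp : (0 : ℝ) < (p2Q : ℝ) := by exact_mod_cast p2Q_facts.1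
  exact cert.dotProduct_le_mul_exp_neg_of_well hsec hfr hp upper_posSemidef hrel hy' hyc ht

/-- The two certified constants as exact rationals: time constant `2p₂/η = 512375/64` and squared amplitude `p₂/ε = 32792/39`
(so the amplitude factor is `√(32792/39)`). -/
theorem rate_constants : 2 * p2Q / etaQ = 512375 / 64 ∧ p2Q / epsQ = 32792 / 39 := by
  constructor <;> norm_num [p2Q, etaQ, epsQ]

end Summit.Ventures.GridStability.Bench.WSCC9SP9SlabRate

end
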